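import Summits.NavierStokesRegularity.FluidComputer.RowRun
import HarnessLib

/-!
# `RowSegment`: canonical frames, junction soundness, and soundness of a segment of the row chain
# (`pub-fluidc-bp3/R1-DESIGN.md` §8.5 / §8.8 (3) — the induction `I(n) ⇒ I(n+1)` between switches)

HONEST FRAMING (cell `pub-fluidc`, blueprint seat bp3, gen 21): low prior, high value-of-information
experiment on Tao's machine paradigm; NOT a claim that NS blows up. No fluid mechanics.

* `canon`: the CANONICAL real frames of a row — the lower endpoints `lo/2^P` of the four interval
  tables (`cert`/`row_sound` hold for ANY real frames in the tables, so the run fixes this choice;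
  it makes frame sharing at a junction an equality of integer tables, `juncOK`).
* `z_junction`: under `juncOK r r'` the next row's model, started at `T₀ + H_r` with the same member
  data, has the same frame coordinates `z` there as this row's model, and `ubR r' 0 = ubR r (2^msub)`
  (`ubR_junction`); with `row_end` (the block-box conclusion of `row_sound` at the row end) this is
  the hand-over `junction_hu0` of the start-box hypothesis `hu0` from row to row.
* `segment_sound`: the induction along consecutive rows `R 0, …, R (n−1)` (canonical frames, row starts `T (k+1) = T k + H_k`, one member)
that chains `RowData.row_sound` through `RowData.junction_hu0`: if every row passes `runOK`, consecutive
rows pass `juncOK`, the member satisfies each row's `MemberOn` hypotheses on that row and its frame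
coordinates start in the box `u` of row `0`, then on every row it stays in the certified boxes `Ē`, `W̄`,
starts in that row's box `u`, and its phase rate is within `ρ` of `1` (`segment_sound`); `segment_sound_of_chainOK`
reads the two Boolean hypotheses off a run file's `chainOK`.

[cite: Tao2016AveragedNS, §5.5 Thm 5.3 (5.5)]
-/

namespace Summit.NavierStokesRegularity.FluidComputer

open Literature.Analysis.FluidPDE.FluidComputer

namespace RowCheck

open DIVec ChainField Finset Real Set Matrix

/-! ### Canonical real matrices of an interval table -/

/-- The lower-endpoint matrix `lo/2^P` of an interval table. [folklore] -/
noncomputable def loM (P : ℕ) (M : Fin 9 → Fin 9 → DI) : Matrix (Fin 9) (Fin 9) ℝ :=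
  fun i j => ((M i j).lo : ℝ) / 2 ^ P

/-- It is enclosed by the table when `lo ≤ hi`. [folklore] -/
theorem mem_loM {P : ℕ} {M : Fin 9 → Fin 9 → DI} (h : ∀ i j, (M i j).lo ≤ (M i j).hi)
    (i j : Fin 9) : (M i j).mem P (loM P M i j) := by
  simp only [DI.mem, loM, div_mul_cancel₀ _ (pow_ne_zero P (two_ne_zero (α := ℝ)))]
  exact ⟨le_rfl, by exact_mod_cast h i j⟩

/-- `x̂` at a rational argument is the cast of `evalQ`. [folklore] -/
theorem xh_ratCast (CQ : Fin 9 → List ℚ) (x : ℚ) (a : Fin 9) :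
    xh CQ (x : ℝ) a = ((evalQ (CQ a) x : ℚ) : ℝ) := by
  rw [xh_eq_sum, evalQ]
  push_cast
  rfl

namespace RowData

variable {r : RowData}

/-! ### Canonical frames -/

/-- **The canonical real frames of a row**: lower endpoints of the four tables. [folklore] -/
noncomputable def canon (h : r.framesOK = true) : r.Frames where
  A0 := loM r.P r.A0I
  A1 := loM r.P r.A1I
  T0 := loM r.P r.T0I
  T1 := loM r.P r.T1I
  hA0 := mem_loM fun i j => ((framesOK_iff r).mp h i j).1
  hA1 := mem_loM fun i j => ((framesOK_iff r).mp h i j).2.1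
  hT0 := mem_loM fun i j => ((framesOK_iff r).mp h i j).2.2.1
  hT1 := mem_loM fun i j => ((framesOK_iff r).mp h i j).2.2.2

/-- The canonical frames follow the lock convention. [folklore] -/
theorem canon_hrow (h : r.framesOK = true) (hl : r.lockOK = true) :
    ∀ b, b ≠ r.p → (canon h).A0 0 b = 0 ∧ (canon h).A1 0 b = 0 := by
  intro b hb
  obtain ⟨h0, h1⟩ := (lockOK_iff r).mp hl b hb
  simp [canon, loM, h0, h1]

/-- `A(0) = A₀`. [folklore] -/
theorem Av_zero (Fr : r.Frames) : Fr.Av 0 = Fr.A0 := by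
  simp [Frames.Av]

/-- `A(1) = A₁`. [folklore] -/
theorem Av_one (Fr : r.Frames) : Fr.Av 1 = Fr.A1 := by
  simp [Frames.Av, Frames.dA]

/-! ### Junctions: soundness -/

/-- `ub 0 = u`. [folklore] -/
theorem ubR_zero (i : Fin 8) : r.ubR 0 i = r.toR (r.u i.succ) := by
  simp [ubR, us, blocks]

/-- `uNext = (us (2^msub)).1`. [folklore] -/
theorem uNext_eq : r.rowCheck.uNext = (r.us (2 ^ r.msub)).1 := by
  rw [rowCheck_eq]

/-- **Box hand-over**: the next row's start box is this row's last block box. [folklore] -/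
theorem ubR_junction {r r' : RowData} (hj : juncOK r r' = true) (i : Fin 8) :
    r'.ubR 0 i = r.ubR (2 ^ r.msub) i := by
  obtain ⟨hP, -, -, hu⟩ := juncOK_iff.mp hj
  rw [ubR_zero, ubR, ← uNext_eq, toR, toR, hu i, hP]

/-- **Frame-coordinate hand-over**: started at `T₀ + H` with the same member data, the next row's
model (canonical frames) has the same `z` there as this row's model. [folklore] -/
theorem z_junction {r r' : RowData} (hj : juncOK r r' = true) (h : r.framesOK = true)
    (h' : r'.framesOK = true) (G : r.GateOK) (G' : r'.GateOK) (T0 : ℝ) (m : MemberData)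
    (hH : (r.Hq : ℝ) ≠ 0) :
    (toModel (canon h') G' (T0 + r.Hq) m).z (T0 + r.Hq) = (toModel (canon h) G T0 m).z (T0 + r.Hq) := by
  obtain ⟨hP, hA, hx, -⟩ := juncOK_iff.mp hj
  have hAm : (toModel (canon h') G' (T0 + r.Hq) m).Am (T0 + r.Hq) =
      (toModel (canon h) G T0 m).Am (T0 + r.Hq) := by
    ext i b
    simp only [toModel, sub_self, zero_div, add_sub_cancel_left, div_self hH, Av_zero, Av_one]
    simp only [canon, loM, hA, hP]
  have he : (toModel (canon h') G' (T0 + r.Hq) m).e (T0 + r.Hq) =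
      (toModel (canon h) G T0 m).e (T0 + r.Hq) := by
    ext a
    simp only [RowModel.e, toModel, sub_self, add_sub_cancel_left]
    rw [show (0 : ℝ) = ((0 : ℚ) : ℝ) by simp, xh_ratCast, xh_ratCast, hx a]
  simp only [RowModel.z]
  rw [hAm, he]

/-- **`hu0` hand-over**: a bound by the last block box of this row at `T₀ + H` is the start-box
hypothesis of the next row. [folklore] -/
theorem junction_hu0 {r r' : RowData} (hj : juncOK r r' = true) (h : r.framesOK = true)
    (h' : r'.framesOK = true) (G : r.GateOK) (G' : r'.GateOK) (T0 : ℝ) (m : MemberData)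
    (hH : (r.Hq : ℝ) ≠ 0)
    (hz : ∀ i, |(toModel (canon h) G T0 m).z (T0 + r.Hq) i| ≤ r.ubR (2 ^ r.msub) i) :
    ∀ i, |(toModel (canon h') G' (T0 + r.Hq) m).z (T0 + r.Hq) i| ≤ r'.ubR 0 i := by
  intro i
  rw [z_junction hj h h' G G' T0 m hH, ubR_junction hj]
  exact hz i

variable (Fr : r.Frames) (G : r.GateOK) (T0 : ℝ) (m : MemberData)

/-- `H > 0` on a passing row. [folklore] -/
theorem Hq_pos (hok : r.rowPass = true) : (0 : ℝ) < r.Hq := by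
  exact_mod_cast (nnOK_iff.mp (flags hok).2.2.2.2).2.2.2.2.2.2

/-- The row end in block units: `T₀ + 2^msub · (2^(S−msub) h) = T₀ + H`. [folklore] -/
theorem blocks_end (hok : r.rowPass = true) (he : r.encOK = true) :
    T0 + ((2 ^ r.msub : ℕ) : ℝ) * (2 ^ (r.S - r.msub) * r.hR) = T0 + r.Hq := by
  obtain ⟨-, -, -, hh, -⟩ := flags hok
  obtain ⟨-, -, -, hmS⟩ := (encOK_iff r).mp he
  rw [hR_eq hh]
  push_cast
  obtain ⟨k, hk⟩ := Nat.exists_eq_add_of_le hmS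
  rw [hk, Nat.add_sub_cancel_left, pow_add]
  field_simp

/-- **Row end**: under the hypotheses of `row_sound` on the whole row, the frame coordinates at
`T₀ + H` are in the last block box. [folklore] -/
theorem row_end (hok : r.rowPass = true) (he : r.encOK = true)
    (hrow : ∀ b, b ≠ r.p → Fr.A0 0 b = 0 ∧ Fr.A1 0 b = 0)
    (hmem : (toModel Fr G T0 m).MemberOn (T0 + r.Hq))
    (hu0 : ∀ i, |(toModel Fr G T0 m).z T0 i| ≤ r.ubR 0 i) :
    ∀ i, |(toModel Fr G T0 m).z (T0 + r.Hq) i| ≤ r.ubR (2 ^ r.msub) i := by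
  have hH := Hq_pos (r := r) hok
  obtain ⟨-, -, h3, -⟩ := row_sound Fr G T0 m hok he hrow hmem (by linarith) le_rfl hu0
  have hT := blocks_end T0 hok he
  intro i
  have h := h3 (2 ^ r.msub) hT.le i
  rwa [hT] at h

/-! ### A segment of the chain -/

/-- **Segment soundness** (induction along consecutive rows `R 0, …, R (n−1)` with canonical frames,
row starts `T (k+1) = T k + H_k`, one member): if every row passes its run checks, consecutive rows
pass the junction check, the member satisfies each row's `MemberOn` hypotheses on that row, and
its frame coordinates start in the box `u` of row `0`, then on every row it stays in the certified
boxes, starts in that row's box `u`, and its phase rate is within `ρ` of `1`. [folklore] -/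
theorem segment_sound (R : ℕ → RowData) (hf : ∀ k, (R k).framesOK = true) (Gk : ∀ k, (R k).GateOK)
    (T : ℕ → ℝ) (hT : ∀ k, T (k + 1) = T k + (R k).Hq) (m : MemberData) (n : ℕ)
    (hrun : ∀ k < n, (R k).runOK = true) (hj : ∀ k, k + 1 < n → juncOK (R k) (R (k + 1)) = true)
    (hmem : ∀ k < n, (toModel (canon (hf k)) (Gk k) (T k) m).MemberOn (T (k + 1)))
    (hu0 : ∀ i, |(toModel (canon (hf 0)) (Gk 0) (T 0) m).z (T 0) i| ≤ (R 0).ubR 0 i) :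
    ∀ k < n, (∀ i, |(toModel (canon (hf k)) (Gk k) (T k) m).z (T k) i| ≤ (R k).ubR 0 i) ∧
      (∀ t ∈ Icc (T k) (T (k + 1)), ∀ a, |(toModel (canon (hf k)) (Gk k) (T k) m).e t a| ≤ (R k).EbarR a) ∧
      (∀ t ∈ Icc (T k) (T (k + 1)), ∀ i, |(toModel (canon (hf k)) (Gk k) (T k) m).z t i| ≤ (R k).WbarR i) ∧
      (∀ t ∈ Ico (T k) (T (k + 1)), |m.sd t - 1| ≤ (R k).rhoR) := by
  -- the start-box invariant
  have hstart : ∀ k < n, ∀ i, |(toModel (canon (hf k)) (Gk k) (T k) m).z (T k) i| ≤ (R k).ubR 0 i := by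
    intro k
    induction k with
    | zero => exact fun _ => hu0
    | succ k ih =>
      intro hk
      have hk' : k < n := by omega
      obtain ⟨hok, he, -, hl⟩ := (runOK_iff _).mp (hrun k hk')
      have hz := row_end (canon (hf k)) (Gk k) (T k) m hok he (canon_hrow (hf k) hl)
        (by rw [← hT]; exact hmem k hk') (ih hk')
      have hH : ((R k).Hq : ℝ) ≠ 0 := (Hq_pos (r := R k) hok).ne'
      have h := junction_hu0 (hj k hk) (hf k) (hf (k + 1)) (Gk k) (Gk (k + 1)) (T k) m hH hz
      rwa [← hT] at h
  intro k hk
  obtain ⟨hok, he, -, hl⟩ := (runOK_iff _).mp (hrun k hk)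
  have hH := Hq_pos (r := R k) hok
  obtain ⟨h1, h2, -, h4⟩ := row_sound (canon (hf k)) (Gk k) (T k) m hok he (canon_hrow (hf k) hl)
    (hmem k hk) (by rw [hT]; linarith) (hT k).le (hstart k hk)
  exact ⟨hstart k hk, h1, h2, h4⟩

/-- **Segment soundness from a run file's Boolean**: rows `k0 … k0+n−1` of a checked list `L`
(positions from `0`, no switch position among `k0 … k0+n−2`). [folklore] -/
theorem segment_sound_of_chainOK {sw : List ℕ} {L : List RowData} (d : RowData)
    (hc : chainOK sw 0 L = true) (k0 n : ℕ) (hn : k0 + n ≤ L.length)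
    (hsw : ∀ k, k0 ≤ k → k + 1 < k0 + n → k ∉ sw)
    (hf : ∀ k, (L.getD (k0 + k) d).framesOK = true) (Gk : ∀ k, (L.getD (k0 + k) d).GateOK)
    (T : ℕ → ℝ) (hT : ∀ k, T (k + 1) = T k + (L.getD (k0 + k) d).Hq) (m : MemberData)
    (hmem : ∀ k < n, (toModel (canon (hf k)) (Gk k) (T k) m).MemberOn (T (k + 1)))
    (hu0 : ∀ i, |(toModel (canon (hf 0)) (Gk 0) (T 0) m).z (T 0) i| ≤ (L.getD (k0 + 0) d).ubR 0 i) :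
    ∀ k < n, (∀ i, |(toModel (canon (hf k)) (Gk k) (T k) m).z (T k) i| ≤ (L.getD (k0 + k) d).ubR 0 i) ∧
      (∀ t ∈ Icc (T k) (T (k + 1)), ∀ a,
        |(toModel (canon (hf k)) (Gk k) (T k) m).e t a| ≤ (L.getD (k0 + k) d).EbarR a) ∧
      (∀ t ∈ Icc (T k) (T (k + 1)), ∀ i,
        |(toModel (canon (hf k)) (Gk k) (T k) m).z t i| ≤ (L.getD (k0 + k) d).WbarR i) ∧
      (∀ t ∈ Ico (T k) (T (k + 1)), |m.sd t - 1| ≤ (L.getD (k0 + k) d).rhoR) :=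
  segment_sound (fun k => L.getD (k0 + k) d) hf Gk T hT m n
    (fun k hk => chainOK_runOK d L 0 hc (k0 + k) (by omega))
    (fun k hk => by
      have h := chainOK_juncOK d L 0 hc (k0 + k) (by omega) (by simpa using hsw (k0 + k) (by omega) (by omega))
      simpa [Nat.add_assoc] using h)
    hmem hu0

end RowData

end RowCheck

end Summit.NavierStokesRegularity.FluidComputer
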